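import Mathlib
import HarnessLib
import HarnessLib.Audit
import Summits.BirchSwinnertonDyer.Statement
import Summits.BirchSwinnertonDyer.Rank1Residual.WAll.TargetAdditiveFiveLeSharpSlices
import Summits.BirchSwinnertonDyer.BirchSwinnertonDyer.Theorems.AdditiveKolyvaginRoadManinFrameResidueProperTwistDegree
import Summits.BirchSwinnertonDyer.BirchSwinnertonDyer.Theorems.AdditiveKolyvaginRoadManinFrameTransport
import Summits.BirchSwinnertonDyer.BirchSwinnertonDyer.Theorems.AdditiveKolyvaginRoadManinFrameFromDatum
import Summits.BirchSwinnertonDyer.BirchSwinnertonDyer.Theorems.AdditiveKolyvaginRoadManinFrameOffExceptionClass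
import Summits.BirchSwinnertonDyer.BirchSwinnertonDyer.Theorems.AdditiveKolyvaginRoadManinFrameIstarClass
import Summits.BirchSwinnertonDyer.BirchSwinnertonDyer.Theorems.AdditiveKolyvaginRoadManinGoodOddFrameAdditiveResplitGlue
import Summits.BirchSwinnertonDyer.BirchSwinnertonDyer.Theorems.AdditiveKolyvaginRoadAdditiveKolyvaginKernel
import Summits.BirchSwinnertonDyer.BirchSwinnertonDyer.Theorems.AdditiveKolyvaginRoadManinFrameResidueDegreeClass
import Literature.NumberTheory.EllipticCurves.IsogenyPotentiallyGoodMinimalDiscriminant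
import Literature.NumberTheory.EllipticCurves.KatoAdditiveTwistedValueNeronIntegrality
import HarnessLib.Audit.Status.Attr

/-!
Route: EdixhovenFibreFiveSeven

# Route EdixhovenFibreFiveSeven — Manin p-part at additive p in 5,7 via the stable fibre of X0(p^2
M), closing W-ALL/2.p>=5.r1

LINE (D-0145 ideator seat bsd-idea-3, technique card «finite-model / certified-instrument design»;
bears_on rung W-ALL/2.p>=5.r1 = leaf `Summit.BirchSwinnertonDyer.WAllExclAdditiveFiveLeRankOne`, and
crux #7 `ManinFrameResidueProperR` (stmt-BirchSwinnertonDyer-20709) of route AdditiveKolyvaginRoad).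
No summit and no leaf is proved by this line; it is a typed skeleton. It suffices to show X = K★ ∧
TDS57 ∧ TDS11 together with the shared AKR cruxes (Kolyvagin primitivity, rank-zero residual, off-♯
rank one): K★ = Manin's p-part for the X₀(N)-OPTIMAL curve of STARRED potentially good type (IV*,
III*, II*) at p ∈ {5,7} with E[p] irreducible; TDS57 = the twist-degree inequality v_p(deg φ_V) <
v_p(deg φ_(V⊗χ_p*)) for every UNSTARRED potentially good V (II, III, IV) at p ∈ {5,7}; TDS11 = the
same for unstarred (G)-ordinary members at p ≥ 11 (the registered stub of the AKR skeleton, as an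
item). The split K★/TDS57 is the Kodaira-type dichotomy `ord_p Δ_min ≤ 4 ∨ > 4`, a class invariant
under E[p]-irreducibility (Dokchitser–Dokchitser); the typed glue obligation G57 composes them into
the p ∈ {5,7} residue S57, and the deciding theorem re-runs the proved AKR kernel.
Lean: `StarredOptimalManinUnitFiveSeven → TwistDegreeStepFiveSeven → TwistDegreeStepOrdinary →
MemberManinUnitFiveSevenGlue → KolyvaginPrimitiveAdditive → RankZeroAdditive →
OffSharpRankOneAdditive → PublishedInputsAdditiveKoly → PublishedManinFacts →
Summit.BirchSwinnertonDyer.WAllExclAdditiveFiveLeRankOne`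

## Assembly
The deciding theorem `closes` (glue.lean, elaborates: rc 0, 0 sorries against the rendered context)
USES EVERY ITEM: (1) it proves AKR's `ManinFrameResidueProperR` from G57∘(K★, TDS57) at p < 11 and
from p540328 `stub_memberManinUnit_ordinary_of_twistDegreeStep` over TDS11 at p ≥ 11, then
prime-to-p transport (`ManinFrameTransport.exists_modularParametrizationData_not_dvd_of_partner`)
and the Hoffstein–Luo frame (`ManinFrameFromDatum.exists_oddHeegnerFrame_of_exists_not_dvd`); (2)
the Manin residue class by ČNS + the PROVED degree class (`maninFrameResidueDegreeClass_proof`); (3)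
the Manin-good odd frame by the PROVED gen-2 glue over the PROVED off-exception and Iₙ* class loci;
(4) the PROVED additive Kolyvagin kernel (`additiveKolyvaginKernel_proof`) with
PublishedInputsAdditiveKoly, the frame, KolyvaginPrimitiveAdditive and RankZeroAdditive gives the ♯
slice `WAllExclAdditiveFiveLeRankOneSharp`; OffSharpRankOneAdditive is the off-♯ slice verbatim;
`wAllExclAdditiveFiveLeRankOne_of_sharp_of_offSharp` glues the leaf. Items in two namespaces with
identical bodies are definitionally equal, so the shared items are consumed by AKR's theorems
directly.

CLOSES_TARGET: closes rung W-ALL/2.p>=5.r1 of BirchSwinnertonDyer: Summit.BirchSwinnertonDyer.WAllExclAdditiveFiveLeRankOne (D-0061; not the summit Statement) — the deciding theorem of this route concludes that registered leaf instead of the Statement decl `BirchSwinnertonDyer` (class rung: servable and labelled, never counted as concluding the summit Statement).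

Rationale: WHY THIS LINE. Mechanism (finite model): Edixhoven 1991 computes ord_p of the Manin constant of the
optimal curve from the μ_n-equivariant STABLE FIBRE of X₀(p²M) at p (Edixhoven 1990: two copies of
X₀(M)‾, two Igusa curves, and one hyperelliptic curve y² = x^(p+1)+1 per supersingular point, n =
(p²−1)/2), reading v_p(c) = (v_C(φ*ω) − a)/n off the component C the Néron model of E meets, with
a/n ∈ {1/6,1/4,1/3,2/3,3/4,5/6} the Kodaira exponent [EdixhovenManin1991 Thm 3, Props 4–9;
Edixhoven1990StableReduction]. Only two steps of the printed proof use p > 7: Prop 7 (Raynaud's e <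
p−1 on the base change realising good reduction, degree d ∈ {2,3,4,6}) and p ∤ deg of the optimal
isogeny (Mazur–Kenku); at p ∈ {5,7} the stable fibre is still explicit (genus-2 / genus-3 horizontal
components) and the finite group G = Ẽ[p^∞] ∩ ker(J̃⁰ → J̃⁰_U) that Prop 7 bounds abstractly can be
COMPUTED on it — that computation is the instrument (a finite table: p ∈ {5,7} × starred Kodaira
type × supersingular j-count), and E[p]-irreducibility replaces Mazur–Kenku. The unstarred half is
moved to the starred half by the p*-twist and the proved identity v_p(deg D♭) + 2v_p(c(D)) = v_p(deg
D) + 2v_p(c(D♭)) + 1 (tree: `Additive.padicVal_twist_identity`, valid at 5 ≤ p) [ZagierCMB1985 §1;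
Watkins2002 §2.1], so TDS57 is stated in MODULAR-DEGREE currency, measurable by Watkins' algorithm.
Imported area: arithmetic geometry of integral models of modular curves (Deligne–Rapoport /
Katz–Mazur / Edixhoven) [KatzMazur1985, DeligneRapoport1973]. What it does that prior routes do not:
every Manin attack in the tree (AKR skeleton `birth`: S57 undivided + TDS at p ≥ 11; Kato unit-twist
lever `not_dvd_c_of_unitQuadraticTwist` needs 7 < p; the bsd-f2-manin rows imc/es/desc/an are
transport/Euler-system arguments at p ≥ 11 or per-curve certificates) leaves p ∈ {5,7} to the
Cremona range theorem (N ≤ 5·10⁵, p534837); this line is the first class-wide attack on S57 and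
types its two halves.

RANKED CRUXES. #2 StarredOptimalManinUnitFiveSeven (crux) — K★ — for W/ℚ globally minimal, p ∈
{5,7}, additive at p with no Iₙ* fibre and 4 < ord_p Δ_min (Kodaira IV*, III*, II*), E[p]
irreducible, and D a lattice-optimal conductor-level parametrisation datum (Λ_E = c·Λ_f, i.e. W is
the X₀(N)-optimal curve): p ∤ c(D). Edixhoven's Thm 3 at p = 5, 7. [difficulty: L] (why it might
fail: at p=5 (n=12) and p=7 (n=24) the exponents a = n·(1/6,…,5/6) are small and Raynaud's bound e ≤
p−1 no longer separates the Néron differential from p·(integral), so G may be non-trivial for type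
II* at p=5 (e=6 > p−1=4): an optimal curve with 5 | c would refute it.) [EdixhovenManin1991,
Edixhoven1990StableReduction, AgasheRibetStein2006, CremonaAlgorithms1997]
#3 TwistDegreeStepFiveSeven (crux) — TDS57 — granted modularity: for p ∈ {5,7}, V/ℚ globally
minimal, additive at p with no Iₙ* fibre and ord_p Δ_min ≤ 4 (Kodaira II, III, IV; ordinary or
supersingular potential reduction alike), E[p] irreducible, and W♭ a globally minimal model of V ⊗
χ_(p*): some conductor-level datum D of V has v_p(deg D) < v_p(deg D♭) for every conductor-level
datum D♭ of W♭. [deps: StarredOptimalManinUnitFiveSeven] [difficulty: L] (why it might fail: it says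
Edixhoven's §4 'case 1' (the Néron differential of V dies on the twist side, v_p(deg) jumping by p²)
never happens at p=5,7; a single pair (V, V♭) of conductor p²M beyond 5·10⁵ with v_p(deg V) ≥
v_p(deg V♭) (Watkins' algorithm) kills it.) [EdixhovenManin1991, ZagierCMB1985, Watkins2002,
AgasheRibetStein2012]
#4 TwistDegreeStepOrdinary (crux) — TDS11 — the registered stub `stub_twistDegreeStep` of
`Cruxes/ManinFrameResidueProperR/Lines/birth.lean` as an item: on the p ≥ 11 residue of AKR
(additive, E[p] irreducible, residue clause, all degrees at level N(W) divisible by p), every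
unstarred (G)-ordinary member V ∼ W and every minimal model W♭ of V ⊗ χ_(p*) satisfy: some
conductor-level datum of V has strictly fewer factors p in its degree than every conductor-level
datum of W♭. [difficulty: L] (why it might fail: for potentially ORDINARY V the étale quotient line
of E[p] can specialise into the toric-free part killed by the twist, which is exactly Edixhoven's
case 1; instance-true on 85 108 (G)-ord optimal pairs N < 5·10⁵ but no structural reason in print.)
[EdixhovenManin1991, AgasheRibetStein2012, CesnaviciusNeururerSaha2023]
#5 KolyvaginPrimitiveAdditive (crux) — shared VERBATIM with route AdditiveKolyvaginRoad
(stmt-BirchSwinnertonDyer-21400): Kolyvagin's conjecture mod p at an additive prime p ≥ 5 on the ♯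
locus in the ∀-Manin-good-frame typing. [difficulty: XL] (why it might fail: W. Zhang's proof needs
ramification-level raising at admissible primes with hypotheses stated for N semistable at p; at an
additive p the local deformation condition may fail (Sweeting 2020 treats only some potentially
multiplicative cases).) [WZhang2014, arXiv:1907.06043, Kolyvagin1991]
#6 RankZeroAdditive (crux) — shared VERBATIM with route AdditiveKolyvaginRoad
(stmt-BirchSwinnertonDyer-20133): BSD_p for non-CM E, additive p ≥ 5, analytic rank 0. [difficulty:
XL] (why it might fail: needs an integral main-conjecture divisibility at an additive prime
(Delbourgo's unstable Iwasawa theory gives it only under hypothesis (G) and μ = 0); potentially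
supersingular additive p has no printed Coleman-map side.) [Kato2004,
delbourgo1998-iwasawa-theory-elliptic-curves-at-unstable-primes, SkinnerUrban2014]
#7 OffSharpRankOneAdditive (crux) — shared VERBATIM with route AdditiveKolyvaginRoad
(stmt-BirchSwinnertonDyer-20134): BSD_p for non-CM E, additive p ≥ 5, analytic rank 1, OFF the ♯
locus (image not onto, or p | ord_ℓ Δ at a multiplicative ℓ, or fewer than two multiplicative
primes, or p | Tamagawa). [difficulty: XL] (why it might fail: Jetchev 2008 shows p | c_ℓ forces
extra p-divisibility of the Heegner point, so the Kolyvagin index argument loses exactly the factor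
BSD_p needs; no Euler-system argument in print reaches these rows.) [WZhang2014, Jetchev2008,
GrossZagier1986]
#9 MemberManinUnitFiveSevenGlue (support) — G57, the typed glue obligation (p < 11 port of p540328
`exists_member_not_dvd_c_of_twistDegreeStep`): modularity → Dokchitser–Dokchitser Thm 5.1(1) → K★ →
TDS57 → on the p ∈ {5,7} residue of AKR (binders of the registered S57 verbatim) some globally
minimal member W₀ ∼ W carries a datum at level N(W) with p ∤ c(D₀). Proof plan, tree lemmas only:
no-Iₙ* passes from the member to W (`ManinFrameIstarClass.exists_isIsogenous_forall_ne_Istar_iff`);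
split on ord_p Δ_min(W) ≤ 4; starred ⇒ K★ on the optimal member (`X12.exists_isIsogenous_optimal`,
DD class-invariance of ord_p Δ_min under prime-to-p isogeny) then prime-to-p transport; unstarred ⇒
`exists_minimal_twist_pStar`, K★ on the optimal member of the twist class (ord_p Δ_min + 6 by
`padicValInt_minimalDiscriminantInt_twist_pStar_eq`), transport to W♭, TDS57, and
`padicVal_twist_identity` (5 ≤ p; ord_p j ≥ 0 from additivity with ord_p Δ_min ≤ 4 via 1728Δ = c₄³ −
c₆²). [difficulty: M] [DokchitserDokchitser2015LocalInvariants, EdixhovenManin1991, ZagierCMB1985]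
#9 PublishedInputsAdditiveKoly (support) — shared VERBATIM with route AdditiveKolyvaginRoad
(stmt-BirchSwinnertonDyer-20137): the hypothesis-only bundle of published inputs of the additive
Kolyvagin kernel (Gross–Zagier, Kolyvagin, rank = analytic rank ≤ 1, entire L, modularity,
Hoffstein–Luo, Galois conjugation of Heegner points, McCallum, singular moduli). [difficulty: S]
[GrossZagier1986, Kolyvagin1991, WZhang2014]
#9 PublishedManinFacts (support) — hypothesis-only bundle, BY NAME, of the cite-only named facts the
Manin frame consumes: Edixhoven 1991 Thm 3 in its two tree readings (p > 7), Dokchitser–Dokchitser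
2015 Thm 5.1(1), Mazur 1978 Cor 4.1, Abbes–Ullmo 1996 Thm A, Česnavičius 2018 Thm 1.2 (p = 2),
Česnavičius–Neururer–Saha Thm 1.2. [difficulty: S] [EdixhovenManin1991,
DokchitserDokchitser2015LocalInvariants, Mazur1978, AbbesUllmo1996, Cesnavicius2018,
CesnaviciusNeururerSaha2023]

TWO-LAYER PLAN. Foreseen split of K★ once the instrument table exists: K★ ⇐ K★(p=7; n=24, types
IV*,III*,II*) → K★(p=5; n=12) → K★, and inside each the supersingular-count cases of the stable
fibre; foreseen split of TDS57 by potential reduction: (G)-ordinary (e | p−1: p=5 type III; p=7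
types II, IV) vs potentially supersingular (Edixhoven's own non-ordinary argument, Thm 3 first
sentence, to be re-run at p=5,7). Nothing filed now.

KILL CRITERIA. Refutation of K★ (an X₀(N)-optimal curve, N = p²M beyond Cremona's range, starred
type at p ∈ {5,7}, E[p] irreducible, with p | c — decidable per curve by the one-level
modular-symbol test `not_dvd_c_iff_periodLattice_le_twist`) closes the route
`refuted:StarredOptimalManinUnitFiveSeven` and kills the finite-model mechanism at that (p, type).
Refutation of TDS57 by a modular-degree pair forces the pivot 'TDS57 restricted to potentially
supersingular V' (Edixhoven's non-ordinary sentence) with the (G)-ordinary p ∈ {5,7} cell re-filed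
beside TDS11. A proof of AKR's S57 stub or of `ManinConstantOne` elsewhere moots K★, TDS57 and G57;
a refutation of KolyvaginPrimitiveAdditive breaks this route together with AKR (shared item).

NOT DECOMPOSED YET. The instrument itself — the μ_n fixed-point / cotangent table of the stable
fibre X̃₀(p²M) at p = 5, 7 against Kraus's list of inertial types per Kodaira symbol — is not typed
(the tree has no stable-model vocabulary for X₀(p²M); definition request below); K★ is therefore
stated arithmetically (data D, Kodaira symbols, ord_p Δ_min) and the table lives in the proof. The
per-type children of K★ and the ordinary/supersingular children of TDS57 are layer 2. The shared AKR
cruxes are not decomposed here (their own route owns that).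

CHEAPEST FALSIFIER. One optimal curve: take any X₀(N)-optimal E with 25 ‖ N or 49 ‖ N, N > 5·10⁵
(below that Cremona's table certifies c = 1: tree theorem
`ManinFrameResidueProperCremonaRange.maninFrameResidueProper_of_conductorNorm_le`, p534837), Kodaira
type IV*, III* or II* at p, E[p] irreducible, and test p | c by comparing the Néron lattice with the
period lattice of the newform (modular symbols to precision 1/p; Cremona's `manin` routine). I could
not run it in-session (no modular-symbol engine on the hub; a kit job is the critic's first move).
Second cheapest: Watkins modular degrees of (V, V♭) pairs at p = 5, 7 for TDS57.

NUMBERS. n = (p²−1)/2 = 12 (p=5), 24 (p=7); Kodaira exponents a/n: II 1/6, III 1/4, IV 1/3, IV* 2/3,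
III* 3/4, II* 5/6 [EdixhovenManin1991 Prop 4]; semistability defect e = 12/gcd(12, ord_p Δ_min) ∈
{2,3,4,6}; Raynaud needs e < p − 1: fails for e=6 at p ∈ {5,7} and e=4 at p=5 — exactly the cells
the instrument must decide. Cremona range: c = 1 for all 2 164 260 optimal curves of conductor ≤
5·10⁵ (tree, p534837). Instance evidence for TDS at p ≥ 11: 85 108/85 108 (G)-ord optimal pairs N <
5·10⁵ (cell b2b-bsdres census gen16).

DEFINITION REQUESTS. D1 (for K★'s proof, not its statement): `StableModelX0pSquared` — the stable
model of X₀(p²M) over ℤ_p^nr[p^(1/n)] with its μ_n-action and component list (Edixhoven 1990 Thm),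
topic Literature/NumberTheory/ModularCurves; D2: `KrausInertialType` — the finite list of
ρ̄_(E,p)|I_p per additive Kodaira type at p ≥ 5 [Kraus1990]. Filed after open with `ledger workitem
add --kind definition` if the critic passes the line.

Novelty: Searches (2026-08-27): `lit search --hybrid "Manin constant additive reduction small primes p=5 p=7
stable model X0(p^2)" -n 8` → 8 docs, none on the Manin constant at additive p ≤ 7
([corpus:book:cremona1997-algorithms-modular-elliptic-curves-2nd-ed p.86] = numerical c=1;
[corpus:paper:delbourgo1998-iwasawa-theory-elliptic-curves-at-unstable-primes p.1] = hypothesis (G),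
no Manin); `lit galaxy search "Manin constant|constante de Manin" --star all -n 10` → 18 rows,
nearest [galaxy:pdf:-8807213389083408320] Pal–Agashe (periods of quadratic twists; semistable-at-p
hypotheses) and [galaxy:panama:195532681117774] (Coates–Taylor volume containing Edixhoven-era
surveys); tree: `rg stable|Igusa|Edixhoven` over Summits/BirchSwinnertonDyer → only the p > 7 facts
`edixhoven_not_dvd_maninConstant_*` and the AKR skeleton; cell memo bsd-f2-manin REFUTER-ref2.md
line 47: «no p ≤ 7 Edixhoven in print».
Nearest prior art found: EdixhovenManin1991 (Thm 3: p > 7, starred or non-ordinary ⇒ p ∤ c),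
CesnaviciusNeururerSaha2023 (Thm 1.2: v_p(c) ≤ v_p(deg), all p ≥ 5), AgasheRibetStein2012 (Conj 2.2
/ Thm 2.7: c | deg·N under semistability at p), the AKR registered skeleton
`Cruxes/ManinFrameResidueProperR/Lines/birth.lean` (S57 undivided, TDS at p ≥ 11).
Delta: the first typed attack on the p ∈ {5,7} additive Manin residue — Edixhoven's stable-fibre
valuation formula re-instrumented below his p > 7 threshold (explicit genus-2/3 horizontal
components replace Raynaud's abstract e < p−1 bound, E[p]-i  [refs: book:cremona1997-algorithms-modular-elliptic-curves-2nd-ed, paper:delbourgo1998-iwasawa-theory-elliptic-curves-at-unstable-primes, EdixhovenManin1991, CesnaviciusNeururerSaha2023, AgasheRibetStein2012]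

Barriers (technique_class: finite-model, stable-reduction, manin-constant): - technique_class: finite-model, stable-reduction, manin-constant
- Literature.Barriers.BirchSwinnertonDyer.HeegnerPointBarrier: outside — the leaf and every crux of
this line sit at analytic rank ≤ 1 (`W.analyticRank = 1` / `= 0` binders); the barrier quantifies
over rank ≥ 2.
- Literature.Barriers.BirchSwinnertonDyer.EulerSystemBigImageBarrier: outside for K★/TDS57/TDS11/G57
(no Euler system: integral models of modular curves); the shared KolyvaginPrimitiveAdditive carries
`HasSurjectiveModNGaloisRep p` (big image), so the small-image rows are in OffSharpRankOneAdditive,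
where the bet is AKR's, not this line's.
- Literature.Barriers.BirchSwinnertonDyer.ReducibleAnticyclotomicAtBadP: outside — every Manin crux
here carries `Irr W p`.
- Negatives index: 1 entry (LeadingTermTamePinch, stmt-15532, ordinary leading-term pinch) —
unrelated to Manin constants; nothing here restates it.

History (route lifecycle, newest last):
- 2026-08-27T23:47:53Z · rev 1: dropped stmt-BirchSwinnertonDyer-23790 — planner slip: a second workitem-add call (placeholder signature 'x', same name KatoNeronAndCremonaFacts) created junk item 23790; dropped at once, 23789 is the (planner-bsd-idea-3-g2-0)

sub-problem: BirchSwinnertonDyer · status: open · opened planner-bsd-idea-3-g0-0 2026-08-27T20:37:37Z · rev 3 · ledger route-BirchSwinnertonDyer-EdixhovenFibreFiveSeven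
GENERATED by the gate from the ledger (D-0016/17). Provers cite these decls: `theorem foo : Summit.BirchSwinnertonDyer.BirchSwinnertonDyer.Theses.EdixhovenFibreFiveSeven.<Decl> := …` in Summits/BirchSwinnertonDyer/BirchSwinnertonDyer/Theorems/<Name>.lean.
-/

namespace Summit.BirchSwinnertonDyer.BirchSwinnertonDyer.Theses.EdixhovenFibreFiveSeven

open scoped BigOperators Topology Manifold Classical MeasureTheory ProbabilityTheory Matrix InnerProductSpace ComplexConjugate ContinuousMap
open Filter Set Function TopologicalSpace MeasureTheory

attribute [summit_statement] _root_.BirchSwinnertonDyer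
attribute [summit_statement] _root_.Summit.BirchSwinnertonDyer.WAllExclAdditiveFiveLeRankOne

open Literature

/-- item stmt-BirchSwinnertonDyer-22226 · crux · rank 2 · open · by planner
why it might fail: at p=5 (n=12) and p=7 (n=24) the exponents a = n·(1/6,…,5/6) are small and Raynaud's bound e ≤ p−1 no longer separates the Néron differential from p·(integral), so G may be non-trivial for type II* at p=5 (e=6 > p−1=4): an optimal curve with 5 | c would refute it.
sources: EdixhovenManin1991, Edixhoven1990StableReduction, AgasheRibetStein2006, CremonaAlgorithms1997
[crux] K★ — for W/ℚ globally minimal, p ∈ {5,7}, additive at p with no Iₙ* fibre and 4 < ord_p Δ_min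
(Kodaira IV*, III*, II*), E[p] irreducible, and D a lattice-optimal conductor-level parametrisation
datum (Λ_E = c·Λ_f, i.e. W is the X₀(N)-optimal curve): p ∤ c(D). Edixhoven's Thm 3 at p = 5, 7.
[difficulty: L] -/
@[route_item "route-BirchSwinnertonDyer-EdixhovenFibreFiveSeven"]
def StarredOptimalManinUnitFiveSeven : Prop :=
  ∀ (W : WeierstrassCurve ℚ) [W.IsElliptic] [W.IsGloballyMinimal] (p : ℕ) [Fact p.Prime] [NeZero (W.conductorNorm ℤ)] (D : Literature.NumberTheory.EllipticCurves.ModularForms.ModularParametrizationData W (W.conductorNorm ℤ)), (p = 5 ∨ p = 7) → Literature.NumberTheory.EllipticCurves.Rank1Residual.Addv W p → Literature.NumberTheory.EllipticCurves.Rank1Residual.Irr W p → (∀ (v : IsDedekindDomain.HeightOneSpectrum ℤ) (n : ℕ), Rat.HeightOneSpectrum.natGenerator v = p → W.kodairaSymbolAt v ≠ Literature.NumberTheory.DiophantineGeometry.KodairaSymbol.Istar n) → 4 < padicValInt p W.minimalDiscriminantInt → (∀ z ∈ D.L.lattice, ∃ w ∈ Literature.NumberTheory.EllipticCurves.ModularForms.periodLattice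 D.f, z = D.c * w) → ¬ (p : ℤ) ∣ D.c

/-- item stmt-BirchSwinnertonDyer-23810 · crux · rank 2 · SPLIT (gen 1) into KummerCornerTorsionOptimalManinUnit, SupersingularTorsionOptimalManinUnitFive, KPTransportInputs + glue KPResidueOfCornerLow · direct attempts still welcome (low priority) · by planner
why it might fail: On the KP types the formal group over ℚ_p(ζ_p) carries the p-torsion, Kato's exp* lands in p⁻¹ℤ_p·ω and loses one p (only v_p(c) ≤ 1), ČNS is void when p ∣ deg φ, Edixhoven's fibre at p ≤ 7 is not in print; one optimal III-at-5 / II-at-7 curve with N > 5·10⁵ and p ∣ c refutes it.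
sources: KostersPannekoek2017, Kato2004Asterisque, CesnaviciusNeururerSaha2023, EdixhovenManin1991, Cremona2022ManinConstants
[crux] KP57 — the Kosters–Pannekoek residue of Manin's p-part at p ∈ {5,7}: for every globally
minimal V/ℚ additive at p ∈ {5,7} with E[p] irreducible, no Iₙ* fibre at p, ord_p Δ_min(V) ≤ 4,
whose isogeny class contains a globally minimal member with a ℚ_p-RATIONAL POINT OF ORDER p (by
kp_types_of_torsion_witness only Kodaira II/III at 5, II at 7 — the potentially ordinary Kummer
corner e = p − 1), such that every conductor-level datum of every minimal member has modular degree
divisible by p and N(V) > 5·10⁵: SOME conductor-level datum of V has p ∤ c. Verbatim the hypothesis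
hKP of the landed theorem
TwistDegreeStepFiveSeven.twistDegreeStepFiveSeven_of_kato_cns_cremona_of_kpResidue — the residue of
TDS57 (22227) after every lever in the tree (Kato F″ off the exception, ČNS degree sub-locus,
Cremona's range); with it and the PUB bundles, K★ (22226) and TDS57 follow from the landed
conditional theorems (items StarredOptimalManinUnitFiveSevenOfKato, TwistDegreeStepFiveSevenOfKP). -/
@[route_item "route-BirchSwinnertonDyer-EdixhovenFibreFiveSeven", crux]
def KPResidueManinUnitFiveSeven : Prop :=
  ∀ (p : ℕ) [Fact p.Prime] (V : WeierstrassCurve ℚ) [V.IsElliptic] [V.IsGloballyMinimal] [NeZero (V.conductorNorm ℤ)], (p = 5 ∨ p = 7) → Literature.NumberTheory.EllipticCurves.Rank1Residual.Addv V p → Literature.NumberTheory.EllipticCurves.Rank1Residual.Irr V p → (∀ (v : IsDedekindDomain.HeightOneSpectrum ℤ) (n : ℕ), Rat.HeightOneSpectrum.natGenerator v = p → V.kodairaSymbolAt v ≠ Literature.NumberTheory.DiophantineGeometry.KodairaSymbol.Istar n) → padicValInt p V.minimalDiscriminantInt ≤ 4 → (∃ (W' : WeierstrassCurve ℚ) (_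 : W'.IsElliptic) (_ : W'.IsGloballyMinimal) (P : (W'.baseChange ℚ_[p]).toAffine.Point), WeierstrassCurve.IsIsogenous V W' ∧ P ≠ 0 ∧ p • P = 0) → (∀ (W' : WeierstrassCurve ℚ) [W'.IsElliptic] [W'.IsGloballyMinimal] (D' : Literature.NumberTheory.EllipticCurves.ModularForms.ModularParametrizationData W' (V.conductorNorm ℤ)), WeierstrassCurve.IsIsogenous V W' → p ∣ D'.modularDegree) → 500000 < V.conductorNorm ℤ → ∃ D : Literature.NumberTheory.EllipticCurves.ModularForms.ModularParametrizationData V (V.conductorNorm ℤ), ¬ (p : ℤ) ∣ D.c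

-- parent: KPResidueManinUnitFiveSeven · child (gen 1)
/--     item stmt-BirchSwinnertonDyer-23883 · crux · rank 201 · open
    parent: KPResidueManinUnitFiveSeven · by planner
    why it might fail: Edixhoven's criterion G = 0 ⇒ p ∤ c is printed only for p > 7 (e(U) < p − 1); at (5, e=4) and (7, e=6) the closed-immersion input needs the LINE-6 rigidity and the exponent bookkeeping may stop at v_p(c) ≤ 1.
    sources: EdixhovenManin1991, KostersPannekoek2017, Raynaud1974, TateOort1970, Cremona2022ManinConstants
[crux] CORNER — the Kosters–Pannekoek corner of PSMU: for W globally minimal, additive at p with (p,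
ord_pΔ_min) ∈ {(5,3),(7,2)} (Kodaira III at 5, II at 7: e = p − 1, the Kummer/Teichmüller corner of
the principal series), E[p] irreducible, (G)-ordinary, carrying a ℚ_p-RATIONAL POINT OF ORDER p, and
D its lattice-optimal conductor-level X₀-datum: p ∤ c(D). Verbatim the hypothesis hcorner of the
landed `TeichmullerTwistDescent.principalSeriesOptimalManinUnit_of_cellPS11_of_kato57_of_corner`;
off this corner PSMU at p ∈ {5,7} follows from F″ (cellPS57_of_kato57_of_corner). The descent
mechanism of this route — NMI (Manin index of the Γ₁(pM) optimal quotient A_g prime to p, CES 2003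
Conj 6.1.7 p-part once) and TTC (v_p(c_E) = v_P(Manin index of A_g) through Res E ~ E × A_g over K_e
⊂ ℚ(ζ_p)), formerly the informal-only items 22792/22793 (dropped in this edit for the item cap; text
in the thesis WHY THIS LINE) — is aimed exactly at this cell, where e = p − 1 and K_e = ℚ(ζ_p). -/
@[route_item "route-BirchSwinnertonDyer-EdixhovenFibreFiveSeven"]
def KummerCornerTorsionOptimalManinUnit : Prop :=
  ∀ (W : WeierstrassCurve ℚ) [W.IsElliptic] [W.IsGloballyMinimal] (p : ℕ) [Fact p.Prime] [NeZero (W.conductorNorm ℤ)] (D : Literature.NumberTheory.EllipticCurves.ModularForms.ModularParametrizationData W (W.conductorNorm ℤ)), ((p = 5 ∧ padicValInt p W.minimalDiscriminantInt = 3) ∨ (p = 7 ∧ padicValInt p W.minimalDiscriminantInt = 2)) → Literature.NumberTheory.EllipticCurves.Rank1Residual.Addv W p → Literature.NumberTheory.EllipticCurves.Rank1Residual.Irr W p → Summit.BirchSwinnertonDyer.Rank1Residual.Additive.TypeGOrd W p → (∃ P : (W.baseChange ℚ_[p]).toAffine.Point, p • P = 0 ∧ P ≠ 0) → (∀ z ∈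 D.L.lattice, ∃ w ∈ Literature.NumberTheory.EllipticCurves.ModularForms.periodLattice D.f, z = D.c * w) → ¬ (p : ℤ) ∣ D.c

-- parent: KPResidueManinUnitFiveSeven · child (gen 1)
/--     item stmt-BirchSwinnertonDyer-23884 · crux · rank 202 · open
    parent: KPResidueManinUnitFiveSeven · by planner
    why it might fail: The rigidity pins only the 5-torsion level-1 layer; Edixhoven's passage from «E[5^∞]_U ↪ Néron(J₀(N))_U closed immersion» to 5 ∤ c is printed for p > 7 and at (5, e = 6, n = 12) his exponent a = 12k/6 bookkeeping is unverified (paper cite-only, acq-04346).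
    sources: EdixhovenManin1991, KostersPannekoek2017, TateOort1970, Raynaud1974, Cremona2022ManinConstants
[crux — shared by TTD (SupersingularTorsionOptimalManinUnitFive) and EF57 (LINE 7 child of KP57);
informal refreshed by the pen bsd-idea-3 g3, 2026-08-28] LOW Kosters–Pannekoek cell: W/ℚ minimal, p
= 5, Kodaira II at 5 (ord₅Δ_min = 2; the clauses (5, ord 3) and (7, ord 2) of the signature are
EMPTY under ¬TypeGOrd by Tate's algorithm — III@5 has j̃ = 1728 ordinary, II@7 has j̃ = 0 ordinary),
E[5] irreducible, NOT (G)-ordinary (= potentially SUPERSINGULAR, j̃ = 0 at 5), a ℚ₅-rational point P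
of order 5, D lattice-optimal at the conductor level ⇒ 5 ∤ c(D). CENSUS (instrument j296012, kit
PARI low.gp v2, evidence on this item): box B = 60: 5635 distinct minimal II@5 curves, 1155 (20.5 %)
with ℚ₅-rational 5-torsion, 1152 with E[5] irreducible, ALL wild (5-division field not inside
ℚ₅^nr(ζ₅): forced, e = 6 ∤ 4); inhabited far beyond every Manin table (e.g. [0,−1,0,−48,−53] N =
5165200; [0,−1,0,−23,−18] N = 526800; [0,−1,0,−23,2] N = 798800); control IV@5: 0/91. So the cell is
genuine and not closable by lookup. TREE STATUS: granted F″ the tree has ord₅ c ≤ 1 here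
(`TeichmullerTwistDescentManinAtMostOnceFiveLe.padicValInt_c_le_one_of_kato`) and 5 ∤ c granted F″ +
L-TWIST (`…ManinUnitFrom -/
@[route_item "route-BirchSwinnertonDyer-EdixhovenFibreFiveSeven"]
def SupersingularTorsionOptimalManinUnitFive : Prop :=
  ∀ (W : WeierstrassCurve ℚ) [W.IsElliptic] [W.IsGloballyMinimal] (p : ℕ) [Fact p.Prime] [NeZero (W.conductorNorm ℤ)] (D : Literature.NumberTheory.EllipticCurves.ModularForms.ModularParametrizationData W (W.conductorNorm ℤ)), ((p = 5 ∧ (padicValInt p W.minimalDiscriminantInt = 2 ∨ padicValInt p W.minimalDiscriminantInt = 3)) ∨ (p = 7 ∧ padicValInt p W.minimalDiscriminantInt = 2)) → Literature.NumberTheory.EllipticCurves.Rank1Residual.Addv W p → Literature.NumberTheory.EllipticCurves.Rank1Residual.Irr W p → ¬ Summit.BirchSwinnertonDyer.Rank1Residual.Additive.TypeGOrd W p → (∃ P : (W.baseChange ℚ_[p]).toAffine.Point, p • P = 0 ∧ P ≠ 0) → (∀ z ∈ D.L.lattice, ∃ w ∈ Literature.NumberTheory.EllipticCurves.ModularForms.periodLattice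 D.f, z = D.c * w) → ¬ (p : ℤ) ∣ D.c

-- parent: KPResidueManinUnitFiveSeven · child (gen 1)
/--     item stmt-BirchSwinnertonDyer-24319 · support · rank 203 · open
    parent: KPResidueManinUnitFiveSeven · by planner
    sources: BreuilConradDiamondTaylor2001, DokchitserDokchitser2015LocalInvariants
[support] Literature-input bundle for the KP57 split glue: modularity of elliptic curves over ℚ in
the tree's newform form (`exists_isNewformOf`, BCDT 2001) and Dokchitser–Dokchitser 2015 Thm 5.1(1)
(prime-to-p isogenies preserve ord_p Δ_min at potentially good p) — both already conjuncts of
PublishedInputsAdditiveKoly / PublishedManinFacts; closable by `⟨hP.2.2.2.2.2.1, hF.2.2.1⟩`-style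
projection once those bundles are in context, or directly from the named facts. [difficulty: S] -/
@[route_item "route-BirchSwinnertonDyer-EdixhovenFibreFiveSeven"]
def KPTransportInputs : Prop :=
  Literature.NumberTheory.EllipticCurves.ModularForms.exists_isNewformOf ∧ Literature.NumberTheory.EllipticCurves.dokchitser_padicValInt_minimalDiscriminantInt_eq_of_isogeny_of_not_dvd_degree

-- parent: KPResidueManinUnitFiveSeven · glue (gen 1)
/--     item stmt-BirchSwinnertonDyer-24320 · support · rank 204 · closed · proved by Summit.BirchSwinnertonDyer.BirchSwinnertonDyer.Theorems.KPResidueOfCornerLow.kpResidueOfCornerLow_proof (prover)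
    parent: KPResidueManinUnitFiveSeven · GLUE: children ⟹ parent · by planner
KP57 SPLIT GLUE `CORNER → LOW → KPTransportInputs → KPResidueManinUnitFiveSeven` (critic idea-crit-5
price (1): KP57 ⇐ CORNER, recorded as an item; M-sized, NOT pure logic — one genuine step). from
`exists_isNewformOf` get the newform f of V at level N = N(V);
`Literature.NumberTheory.Automorphic.exists_optimal_modularParametrizationData_of_isNewformOf'`
gives a globally minimal W₀ ∼ V with a degree-minimal datum D₀ at level N, and
`latticeEq_of_exists_optimal_modularParametrizationData` (OptimalProofs) its lattice clause;
Addv/Irr transport by `X2.addv_iff_of_isIsogenous` / the Irr analogue; `kp_types_of_torsion_witness`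
(EdixhovenFibreFiveSevenTwistDegreeStepFiveSeven) + the DD hypothesis put (p, ord_pΔ(W₀)) in
{(5,2),(5,3),(7,2)} (potential good reduction from «additive, no Iₙ* fibre»: j integral); the
ℚ_p-rational p-torsion point moves from the witness W′ to W₀ along a cyclic ℚ-isogeny of degree
prime to p (`IsIsogenous.exists_isCyclic`, `X11b.not_dvd_degree_of_isCyclic_of_irr`; p-torsion
points are algebraic, the isogeny is G_ℚ-equivariant on geometric points, so D_p-invariants map to
D_p-invariants injectively on p-torsion) — THIS is the one step without a ready-made tree lem -/
@[route_item "route-BirchSwinnertonDyer-EdixhovenFibreFiveSeven"]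
def KPResidueOfCornerLow : Prop :=
  KummerCornerTorsionOptimalManinUnit → SupersingularTorsionOptimalManinUnitFive → KPTransportInputs → KPResidueManinUnitFiveSeven

-- `KPResidueOfCornerLow` holds: proved by `Summit.BirchSwinnertonDyer.BirchSwinnertonDyer.Theorems.KPResidueOfCornerLow.kpResidueOfCornerLow_proof` (its module imports this route file, so no `_holds` link can be stated here).

/-- item stmt-BirchSwinnertonDyer-22227 · crux · rank 3 · open · by planner
why it might fail: it says Edixhoven's §4 'case 1' (the Néron differential of V dies on the twist side, v_p(deg) jumping by p²) never happens at p=5,7; a single pair (V, V♭) of conductor p²M beyond 5·10⁵ with v_p(deg V) ≥ v_p(deg V♭) (Watkins' algorithm) kills it.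
sources: EdixhovenManin1991, ZagierCMB1985, Watkins2002, AgasheRibetStein2012
[crux] TDS57 — granted modularity: for p ∈ {5,7}, V/ℚ globally minimal, additive at p with no Iₙ*
fibre and ord_p Δ_min ≤ 4 (Kodaira II, III, IV; ordinary or supersingular potential reduction
alike), E[p] irreducible, and W♭ a globally minimal model of V ⊗ χ_(p*): some conductor-level datum
D of V has v_p(deg D) < v_p(deg D♭) for every conductor-level datum D♭ of W♭. [deps:
StarredOptimalManinUnitFiveSeven] [difficulty: L] -/
@[route_item "route-BirchSwinnertonDyer-EdixhovenFibreFiveSeven"]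
def TwistDegreeStepFiveSeven : Prop :=
  Literature.NumberTheory.EllipticCurves.ModularForms.exists_isNewformOf → ∀ (p : ℕ) [Fact p.Prime] (V : WeierstrassCurve ℚ) [V.IsElliptic] [V.IsGloballyMinimal] [NeZero (V.conductorNorm ℤ)] (Wf : WeierstrassCurve ℚ) [Wf.IsElliptic] [Wf.IsGloballyMinimal] [NeZero (Wf.conductorNorm ℤ)] (C : WeierstrassCurve.VariableChange ℚ), (p = 5 ∨ p = 7) → Literature.NumberTheory.EllipticCurves.Rank1Residual.Addv V p → Literature.NumberTheory.EllipticCurves.Rank1Residual.Irr V p → (∀ (v : IsDedekindDomain.HeightOneSpectrum ℤ) (n : ℕ), Rat.HeightOneSpectrum.natGenerator v = p → V.kodairaSymbolAt v ≠ Literature.NumberTheory.DiophantineGeometry.KodairaSymbol.Istar n) → padicValInt p V.minimalDiscriminantInt ≤ 4 → C • V.quadraticTwist ((-1 : ℚ) ^ (p / 2) * p) = Wf → ∃ D : Literature.NumberTheory.EllipticCurves.ModularForms.ModularParametrizationData V (V.conductorNorm ℤ), ∀ Df : Literature.NumberTheory.EllipticCurves.ModularForms.ModularParametrizationData Wf (Wf.conductorNorm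 ℤ), padicValNat p D.modularDegree < padicValNat p Df.modularDegree

/-- item stmt-BirchSwinnertonDyer-22228 · crux · rank 4 · open · by planner
why it might fail: for potentially ORDINARY V the étale quotient line of E[p] can specialise into the toric-free part killed by the twist, which is exactly Edixhoven's case 1; instance-true on 85 108 (G)-ord optimal pairs N < 5·10⁵ but no structural reason in print.
sources: EdixhovenManin1991, AgasheRibetStein2012, CesnaviciusNeururerSaha2023
[crux] TDS11 — the registered stub `stub_twistDegreeStep` of
`Cruxes/ManinFrameResidueProperR/Lines/birth.lean` as an item: on the p ≥ 11 residue of AKR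
(additive, E[p] irreducible, residue clause, all degrees at level N(W) divisible by p), every
unstarred (G)-ordinary member V ∼ W and every minimal model W♭ of V ⊗ χ_(p*) satisfy: some
conductor-level datum of V has strictly fewer factors p in its degree than every conductor-level
datum of W♭. [difficulty: L] -/
@[route_item "route-BirchSwinnertonDyer-EdixhovenFibreFiveSeven", crux]
def TwistDegreeStepOrdinary : Prop :=
  Literature.NumberTheory.EllipticCurves.ModularForms.exists_isNewformOf → ∀ (W : WeierstrassCurve ℚ) [W.IsElliptic] [W.IsGloballyMinimal] (p : ℕ) [Fact p.Prime] [NeZero (W.conductorNorm ℤ)], 11 ≤ p → Literature.NumberTheory.EllipticCurves.Rank1Residual.Addv W p → Literature.NumberTheory.EllipticCurves.Rank1Residual.Irr W p → ((p < 11 ∨ ∃ (W' : WeierstrassCurve ℚ) (_ : W'.IsElliptic) (_ : W'.IsGloballyMinimal), WeierstrassCurve.IsIsogenous W W' ∧ Summit.BirchSwinnertonDyer.Rank1Residual.Additive.TypeGOrd W' p ∧ padicValInt p W'.minimalDiscriminantInt ≤ 4) ∧ (∃ (W' : WeierstrassCurve ℚ) (_ : W'.IsElliptic) (_ : W'.IsGloballyMinimal),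 WeierstrassCurve.IsIsogenous W W' ∧ ∀ (v : IsDedekindDomain.HeightOneSpectrum ℤ) (n : ℕ), Rat.HeightOneSpectrum.natGenerator v = p → W'.kodairaSymbolAt v ≠ Literature.NumberTheory.DiophantineGeometry.KodairaSymbol.Istar n)) → (∀ (W' : WeierstrassCurve ℚ) [W'.IsElliptic] [W'.IsGloballyMinimal] (D' : Literature.NumberTheory.EllipticCurves.ModularForms.ModularParametrizationData W' (W.conductorNorm ℤ)), WeierstrassCurve.IsIsogenous W W' → p ∣ D'.modularDegree) → ∀ (V : WeierstrassCurve ℚ) [V.IsElliptic] [V.IsGloballyMinimal] [NeZero (V.conductorNorm ℤ)] (Wf : WeierstrassCurve ℚ) [Wf.IsElliptic] [Wf.IsGloballyMinimal] [NeZero (Wf.conductorNorm ℤ)] (C : WeierstrassCurve.VariableChange ℚ), WeierstrassCurve.IsIsogenous W V → Summit.BirchSwinnertonDyer.Rank1Residual.Additive.TypeGOrd V p → padicValInt p V.minimalDiscriminantInt ≤ 4 → C • V.quadraticTwist ((-1 : ℚ) ^ (p / 2) * p) = Wf → ∃ D : Literature.NumberTheory.EllipticCurves.ModularForms.ModularParametrizationData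 V (V.conductorNorm ℤ), ∀ Df : Literature.NumberTheory.EllipticCurves.ModularForms.ModularParametrizationData Wf (Wf.conductorNorm ℤ), padicValNat p D.modularDegree < padicValNat p Df.modularDegree

/-- item stmt-BirchSwinnertonDyer-21400 · crux · rank 5 · open · by planner
why it might fail: W. Zhang's proof needs ramification-level raising at admissible primes with hypotheses stated for N semistable at p; at an additive p the local deformation condition may fail (Sweeting 2020 treats only some potentially multiplicative cases).
sources: WZhang2014, arXiv:1907.06043, Kolyvagin1991
[crux] Kolyvagin's conjecture mod p at an additive prime p ≥ 5 in the ∀-Manin-good-frame ♯ typing of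
the p = 3 kernel: for every frame (W, p, K, Dt, β, ι) with 5 ≤ p, Addv W p, ρ̄ onto, ♠(1), ♠(2), p ∤
∏c, r_an = 1, K imaginary quadratic with odd d_K, Heegner hypothesis, L(E^(d_K),1) ≠ 0, 4N ∣ β² −
d_K, p ∤ c_Manin(Dt): some Kolyvagin–Heegner datum of Kolyvagin-prime support has c(1) ≠ 0 in H¹(K,
E[p]). [difficulty: open-problem] -/
@[route_item "route-BirchSwinnertonDyer-EdixhovenFibreFiveSeven", crux]
def KolyvaginPrimitiveAdditive : Prop :=
  ∀ (W : WeierstrassCurve ℚ) [W.IsElliptic] [W.IsGloballyMinimal] [NeZero (W.conductorNorm ℤ)] (p : ℕ) [Fact p.Prime] (K : Type) [Field K] [NumberField K] (Dt : Literature.NumberTheory.EllipticCurves.ModularForms.ModularParametrizationData W (W.conductorNorm ℤ)) (β : ℤ) (ι : K →+* ℂ), 5 ≤ p → Literature.NumberTheory.EllipticCurves.Rank1Residual.Addv W p → W.HasSurjectiveModNGaloisRep p → (∀ (ℓ : ℕ) [Fact ℓ.Prime], W.HasMultiplicativeReductionAtPrime ℓ → ¬ p ∣ padicValInt ℓ W.minimalDiscriminantInt)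 → (∃ (ℓ₁ ℓ₂ : ℕ) (_ : Fact ℓ₁.Prime) (_ : Fact ℓ₂.Prime), ℓ₁ ≠ ℓ₂ ∧ W.HasMultiplicativeReductionAtPrime ℓ₁ ∧ W.HasMultiplicativeReductionAtPrime ℓ₂) → ¬ p ∣ W.tamagawaProduct → W.analyticRank = 1 → Literature.NumberTheory.EllipticCurves.IsImaginaryQuadratic K → Odd (NumberField.discr K) → NumberField.discr K < -4 → Literature.NumberTheory.EllipticCurves.SatisfiesHeegnerHypothesis (W.conductorNorm ℤ) K → (W.quadraticTwist (NumberField.discr K : ℚ)).entireLFunction 1 ≠ 0 → (4 * (W.conductorNorm ℤ : ℤ)) ∣ β ^ 2 - NumberField.discr K → ¬ (p : ℤ) ∣ Dt.c → ∃ (n : ℕ) (d : Literature.NumberTheory.EllipticCurves.KolyvaginHeegnerData Dt β ι n), Literature.NumberTheory.EllipticCurves.KolyvaginDescent.KolSupp (Literature.NumberTheory.EllipticCurves.Zhang2014.IsKolyvaginPrime (W.conductorNorm ℤ) W K p) n ∧ d.kolyvaginClass (Fact.out : p.Prime) 1 ≠ 0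

/-- item stmt-BirchSwinnertonDyer-20133 · crux · rank 6 · open · by planner
why it might fail: needs an integral main-conjecture divisibility at an additive prime (Delbourgo's unstable Iwasawa theory gives it only under hypothesis (G) and μ = 0); potentially supersingular additive p has no printed Coleman-map side.
sources: Kato2004, delbourgo1998-iwasawa-theory-elliptic-curves-at-unstable-primes, SkinnerUrban2014
[crux] RESIDUAL (imported complement, attacked by the sibling routes AdditiveBranchIMC /
QuadraticBranchSignedControl / KatoDescentTamePotSupersingular / KatoDescentPotSupersingular): BSD_p
for every non-CM E/ℚ of analytic rank 0 at every additive prime p ≥ 5. It is also consumed INSIDE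
the kernel (the twist E^(d_K) has rank 0 and the same additive type at p). [difficulty:
open-problem] -/
@[route_item "route-BirchSwinnertonDyer-EdixhovenFibreFiveSeven", crux]
def RankZeroAdditive : Prop :=
  ∀ (W : WeierstrassCurve ℚ) [W.IsElliptic] [W.IsGloballyMinimal] (p : ℕ) [Fact p.Prime], ¬ W.HasCM → 5 ≤ p → Literature.NumberTheory.EllipticCurves.Rank1Residual.Addv W p → W.analyticRank = 0 → Literature.NumberTheory.EllipticCurves.BSDp W p

/-- item stmt-BirchSwinnertonDyer-20134 · crux · rank 7 · open · by planner
why it might fail: Jetchev 2008 shows p | c_ℓ forces extra p-divisibility of the Heegner point, so the Kolyvagin index argument loses exactly the factor BSD_p needs; no Euler-system argument in print reaches these rows.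
sources: WZhang2014, Jetchev2008, GrossZagier1986
[crux] RESIDUAL: BSD_p for the non-CM rank-one additive rows at p ≥ 5 OFF the ♯ locus (ρ̄_(E,p) not
onto, or ♠ fails, or p ∣ ∏ c_ℓ) — the rows no Heegner-point Kolyvagin argument in print reaches
(Jetchev: p ∣ c_ℓ forces extra divisibility of y_K). [difficulty: open-problem] -/
@[route_item "route-BirchSwinnertonDyer-EdixhovenFibreFiveSeven", crux]
def OffSharpRankOneAdditive : Prop :=
  ∀ (W : WeierstrassCurve ℚ) [W.IsElliptic] [W.IsGloballyMinimal] (p : ℕ) [Fact p.Prime], ¬ W.HasCM → 5 ≤ p → Literature.NumberTheory.EllipticCurves.Rank1Residual.Addv W p → W.analyticRank = 1 → ¬ (W.HasSurjectiveModNGaloisRep p ∧ (∀ (ℓ : ℕ) [Fact ℓ.Prime], W.HasMultiplicativeReductionAtPrime ℓ → ¬ p ∣ padicValInt ℓ W.minimalDiscriminantInt) ∧ (∃ (ℓ₁ ℓ₂ : ℕ) (_ : Fact ℓ₁.Prime) (_ : Fact ℓ₂.Prime), ℓ₁ ≠ ℓ₂ ∧ W.HasMultiplicativeReductionAtPrime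 ℓ₁ ∧ W.HasMultiplicativeReductionAtPrime ℓ₂) ∧ ¬ p ∣ W.tamagawaProduct) → Literature.NumberTheory.EllipticCurves.BSDp W p

/-- item stmt-BirchSwinnertonDyer-20137 · support · rank 9 · open · by planner
sources: GrossZagier1986, Kolyvagin1991, WZhang2014
[support] the conjunction of the tree's NAMED published facts the kernel consumes (Gross–Zagier,
Kolyvagin, Kolyvagin's Ш-bound, GZK rank over ℚ, modularity, newforms, Hoffstein–Luo,
Galois-conjugation of the conductor-1 Heegner point, McCallum's structure theorem, Darmon Thm 3.6) —
hypotheses, never asserted. [difficulty: provable-now] -/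
@[route_item "route-BirchSwinnertonDyer-EdixhovenFibreFiveSeven", crux]
def PublishedInputsAdditiveKoly : Prop :=
  (∀ (N : ℕ) [NeZero N] (W : WeierstrassCurve ℚ) (K : Type) [Field K] [NumberField K], Literature.NumberTheory.EllipticCurves.gross_zagier N W K) ∧ (∀ (N : ℕ) [NeZero N] (W : WeierstrassCurve ℚ) (K : Type) [Field K] [NumberField K], Literature.NumberTheory.EllipticCurves.kolyvagin N W K) ∧ (∀ (N : ℕ) [NeZero N] (W : WeierstrassCurve ℚ) (K : Type) [Field K] [NumberField K], Literature.NumberTheory.EllipticCurves.Kolyvagin1990_padicValNat_card_sha_le N W K) ∧ Literature.NumberTheory.EllipticCurves.rank_eq_analyticRank_of_analyticRank_le_one ∧ WeierstrassCurve.hasEntireLFunction_rat ∧ Literature.NumberTheory.EllipticCurves.ModularForms.exists_isNewformOf ∧ Literature.NumberTheory.EllipticCurves.HoffsteinLuo1997_exists_twist_L_one_ne_zero ∧ (∀ (N : ℕ) [NeZero N] (W : WeierstrassCurve ℚ) (K : Type) [Field K] [NumberField K], Literature.NumberTheory.EllipticCurves.heegnerPointOfConductor_one_galoisConj N W K) ∧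 Literature.NumberTheory.EllipticCurves.McCallum1991_pow_dvd_card_sha_primary_of_certificate ∧ (∀ (N : ℕ) [NeZero N] (W : WeierstrassCurve ℚ) (K : Type) [Field K] [NumberField K], Literature.NumberTheory.EllipticCurves.phi_heegnerTau_mem_range_map_singularModuliField N W K)

/-- item stmt-BirchSwinnertonDyer-22229 · support · rank 9 · closed · proved by Summit.BirchSwinnertonDyer.BirchSwinnertonDyer.Theorems.MemberManinUnitFiveSevenGlue.memberManinUnitFiveSevenGlue_proof (prover) · by planner
sources: DokchitserDokchitser2015LocalInvariants, EdixhovenManin1991, ZagierCMB1985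
[support] G57, the typed glue obligation (p < 11 port of p540328
`exists_member_not_dvd_c_of_twistDegreeStep`): modularity → Dokchitser–Dokchitser Thm 5.1(1) → K★ →
TDS57 → on the p ∈ {5,7} residue of AKR (binders of the registered S57 verbatim) some globally
minimal member W₀ ∼ W carries a datum at level N(W) with p ∤ c(D₀). Proof plan, tree lemmas only:
no-Iₙ* passes from the member to W (`ManinFrameIstarClass.exists_isIsogenous_forall_ne_Istar_iff`);
split on ord_p Δ_min(W) ≤ 4; starred ⇒ K★ on the optimal member (`X12.exists_isIsogenous_optimal`,
DD class-invariance of ord_p Δ_min under prime-to-p isogeny) then prime-to-p transport; unstarred ⇒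
`exists_minimal_twist_pStar`, K★ on the optimal member of the twist class (ord_p Δ_min + 6 by
`padicValInt_minimalDiscriminantInt_twist_pStar_eq`), transport to W♭, TDS57, and
`padicVal_twist_identity` (5 ≤ p; ord_p j ≥ 0 from additivity with ord_p Δ_min ≤ 4 via 1728Δ = c₄³ −
c₆²). [difficulty: M] -/
@[route_item "route-BirchSwinnertonDyer-EdixhovenFibreFiveSeven", crux]
def MemberManinUnitFiveSevenGlue : Prop :=
  Literature.NumberTheory.EllipticCurves.ModularForms.exists_isNewformOf → Literature.NumberTheory.EllipticCurves.dokchitser_padicValInt_minimalDiscriminantInt_eq_of_isogeny_of_not_dvd_degree → StarredOptimalManinUnitFiveSeven → TwistDegreeStepFiveSeven → ∀ (W : WeierstrassCurve ℚ) [W.IsElliptic] [W.IsGloballyMinimal] (p : ℕ) [Fact p.Prime] [NeZero (W.conductorNorm ℤ)], 5 ≤ p → p < 11 → Literature.NumberTheory.EllipticCurves.Rank1Residual.Addv W p → Literature.NumberTheory.EllipticCurves.Rank1Residual.Irr W p → ((p < 11 ∨ ∃ (W' : WeierstrassCurve ℚ) (_ : W'.IsElliptic) (_ : W'.IsGloballyMinimal),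 WeierstrassCurve.IsIsogenous W W' ∧ Summit.BirchSwinnertonDyer.Rank1Residual.Additive.TypeGOrd W' p ∧ padicValInt p W'.minimalDiscriminantInt ≤ 4) ∧ (∃ (W' : WeierstrassCurve ℚ) (_ : W'.IsElliptic) (_ : W'.IsGloballyMinimal), WeierstrassCurve.IsIsogenous W W' ∧ ∀ (v : IsDedekindDomain.HeightOneSpectrum ℤ) (n : ℕ), Rat.HeightOneSpectrum.natGenerator v = p → W'.kodairaSymbolAt v ≠ Literature.NumberTheory.DiophantineGeometry.KodairaSymbol.Istar n)) → (∀ (W' : WeierstrassCurve ℚ) [W'.IsElliptic] [W'.IsGloballyMinimal] (D' : Literature.NumberTheory.EllipticCurves.ModularForms.ModularParametrizationData W' (W.conductorNorm ℤ)), WeierstrassCurve.IsIsogenous W W' → p ∣ D'.modularDegree) → ∃ (W₀ : WeierstrassCurve ℚ) (_ : W₀.IsElliptic) (_ : W₀.IsGloballyMinimal) (D₀ : Literature.NumberTheory.EllipticCurves.ModularForms.ModularParametrizationData W₀ (W.conductorNorm ℤ)), WeierstrassCurve.IsIsogenous W W₀ ∧ ¬ (p : ℤ) ∣ D₀.c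

-- `MemberManinUnitFiveSevenGlue` holds: proved by `Summit.BirchSwinnertonDyer.BirchSwinnertonDyer.Theorems.MemberManinUnitFiveSevenGlue.memberManinUnitFiveSevenGlue_proof` (its module imports this route file, so no `_holds` link can be stated here).

/-- item stmt-BirchSwinnertonDyer-22230 · support · rank 9 · open · by planner
sources: EdixhovenManin1991, DokchitserDokchitser2015LocalInvariants, Mazur1978, AbbesUllmo1996, Cesnavicius2018, CesnaviciusNeururerSaha2023
[support] hypothesis-only bundle, BY NAME, of the cite-only named facts the Manin frame consumes:
Edixhoven 1991 Thm 3 in its two tree readings (p > 7), Dokchitser–Dokchitser 2015 Thm 5.1(1), Mazur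
1978 Cor 4.1, Abbes–Ullmo 1996 Thm A, Česnavičius 2018 Thm 1.2 (p = 2), Česnavičius–Neururer–Saha
Thm 1.2. [difficulty: S] -/
@[route_item "route-BirchSwinnertonDyer-EdixhovenFibreFiveSeven", crux]
def PublishedManinFacts : Prop :=
  Literature.NumberTheory.EllipticCurves.ModularForms.edixhoven_not_dvd_maninConstant_of_not_potentiallyGoodOrdinary ∧ Literature.NumberTheory.EllipticCurves.ModularForms.edixhoven_not_dvd_maninConstant_of_kodairaSymbol_ne ∧ Literature.NumberTheory.EllipticCurves.dokchitser_padicValInt_minimalDiscriminantInt_eq_of_isogeny_of_not_dvd_degree ∧ Literature.NumberTheory.EllipticCurves.ModularForms.mazur_not_dvd_maninConstant_of_odd ∧ Literature.NumberTheory.EllipticCurves.ModularForms.abbesUllmo_not_dvd_maninConstant_of_not_dvd_level ∧ Literature.NumberTheory.EllipticCurves.ModularForms.cesnavicius_not_two_dvd_maninConstant_of_two_dvd_level ∧ Literature.NumberTheory.EllipticCurves.ModularForms.cesnaviciusNeururerSaha_padicVal_maninConstant_le_modularDegree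

/-- item stmt-BirchSwinnertonDyer-23789 · support · rank 9 · open · by planner
[support] hypothesis-only PUB bundle, BY NAME, of two cite-only named facts consumed by the landed
conditional theorems of this route: F″ = Kato 2004 (8.1.3)/Thm 9.7 + Kim–Nakamura 2020 §2 Néron
integrality of twisted symbol sums at additive p ≥ 5 off the Kosters–Pannekoek exception (p576988,
audited), and Cremona’s determined-range datum |c₀| = 1 for N ≤ 5·10⁵ (Cremona2022ManinConstants;
ARS 2006 Thm 2.6). Displayed as hypotheses of closes; never counted as progress. Sources:
Kato2004Asterisque, KimNakamura2020, KostersPannekoek2017, Cremona2022ManinConstants,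
AgasheRibetStein2006. [difficulty: S] -/
@[route_item "route-BirchSwinnertonDyer-EdixhovenFibreFiveSeven", crux]
def KatoNeronAndCremonaFacts : Prop :=
  Literature.NumberTheory.EllipticCurves.kato_neron_isIntegral_twistedSymbolSum_of_additive_five_le ∧ Literature.NumberTheory.EllipticCurves.cremona_abs_maninConstant_eq_one_of_level_le_500000

/-- item stmt-BirchSwinnertonDyer-23811 · support · rank 9 · closed · proved by Summit.BirchSwinnertonDyer.BirchSwinnertonDyer.Theorems.starredOptimalManinUnitFiveSevenOfKato_proof (prover) · by planner
[support] K★ (22226) GRANTED the PUB bundle KatoNeronAndCremonaFacts: closable at once by `fun h =>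
Summit.BirchSwinnertonDyer.BirchSwinnertonDyer.Theorems.starredOptimalManinUnitFiveSeven_of_kato
h.1` (p581141, prover bsd-line-edix-p1; verified in the planner's sketch). The item form lets
`closes` consume the landed conditional theorem without an import cycle. [difficulty: provable-now] -/
@[route_item "route-BirchSwinnertonDyer-EdixhovenFibreFiveSeven", crux]
def StarredOptimalManinUnitFiveSevenOfKato : Prop :=
  KatoNeronAndCremonaFacts → StarredOptimalManinUnitFiveSeven

-- `StarredOptimalManinUnitFiveSevenOfKato` holds: proved by `Summit.BirchSwinnertonDyer.BirchSwinnertonDyer.Theorems.starredOptimalManinUnitFiveSevenOfKato_proof` (its module imports this route file, so no `_holds` link can be stated here).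

/-- item stmt-BirchSwinnertonDyer-23812 · support · rank 9 · closed · proved by Summit.BirchSwinnertonDyer.BirchSwinnertonDyer.Theorems.twistDegreeStepFiveSevenOfKP_proof (prover) · by planner
[support] TDS57 (22227) GRANTED KatoNeronAndCremonaFacts, PublishedManinFacts (its ČNS conjunct) and
the KP residue crux: closable at once by `fun h hF hKP =>
Summit.BirchSwinnertonDyer.BirchSwinnertonDyer.Theorems.TwistDegreeStepFiveSeven.twistDegreeStepFiveSeven_of_kato_cns_cremona_of_kpResidue
h.1 hF.2.2.2.2.2.2 h.2 hKP` (landed; verified in the planner's sketch). [difficulty: provable-now] -/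
@[route_item "route-BirchSwinnertonDyer-EdixhovenFibreFiveSeven", crux]
def TwistDegreeStepFiveSevenOfKP : Prop :=
  KatoNeronAndCremonaFacts → PublishedManinFacts → KPResidueManinUnitFiveSeven → TwistDegreeStepFiveSeven

-- `TwistDegreeStepFiveSevenOfKP` holds: proved by `Summit.BirchSwinnertonDyer.BirchSwinnertonDyer.Theorems.twistDegreeStepFiveSevenOfKP_proof` (its module imports this route file, so no `_holds` link can be stated here).

/-- item stmt-BirchSwinnertonDyer-22231 · assembly · rank 1 · closed · proved by Summit.BirchSwinnertonDyer.BirchSwinnertonDyer.Theorems.EdixhovenFibreFiveSevenAssembly.assembly_proof (prover) · by planner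
sources: EdixhovenManin1991, WZhang2014
[assembly] K★ → TDS57 → TDS11 → G57 → KolyvaginPrimitiveAdditive → RankZeroAdditive →
OffSharpRankOneAdditive → PublishedInputsAdditiveKoly → PublishedManinFacts →
WAllExclAdditiveFiveLeRankOne (rung W-ALL/2.p>=5.r1). -/
@[route_item "route-BirchSwinnertonDyer-EdixhovenFibreFiveSeven"]
def Assembly : Prop :=
  StarredOptimalManinUnitFiveSeven → TwistDegreeStepFiveSeven → TwistDegreeStepOrdinary → MemberManinUnitFiveSevenGlue → KolyvaginPrimitiveAdditive → RankZeroAdditive → OffSharpRankOneAdditive → PublishedInputsAdditiveKoly → PublishedManinFacts → Summit.BirchSwinnertonDyer.WAllExclAdditiveFiveLeRankOne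

-- `Assembly` holds: proved by `Summit.BirchSwinnertonDyer.BirchSwinnertonDyer.Theorems.EdixhovenFibreFiveSevenAssembly.assembly_proof` (its module imports this route file, so no `_holds` link can be stated here).

/-! D-0027 §2.1 — DECIDING THEOREM (planner-authored via `route open/edit --closes-file`; by planner-bsd-idea-3-g2-0 2026-08-27T23:50:50Z):
its hypotheses are this route's items and its conclusion the registered leaf `Summit.BirchSwinnertonDyer.WAllExclAdditiveFiveLeRankOne` (rung W-ALL/2.p>=5.r1, D-0061) (glue_lint), and it elaborates with this file. -/

@[closes "route-BirchSwinnertonDyer-EdixhovenFibreFiveSeven"] theorem closes (hK : KPResidueManinUnitFiveSeven) (hS' : StarredOptimalManinUnitFiveSevenOfKato)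
    (hT' : TwistDegreeStepFiveSevenOfKP) (hO : TwistDegreeStepOrdinary) (hG : MemberManinUnitFiveSevenGlue)
    (h₁ : KolyvaginPrimitiveAdditive) (h₀ : RankZeroAdditive) (hoff : OffSharpRankOneAdditive)
    (hP : PublishedInputsAdditiveKoly) (hF : PublishedManinFacts) (hPK : KatoNeronAndCremonaFacts) :
    Summit.BirchSwinnertonDyer.WAllExclAdditiveFiveLeRankOne := by
  -- K★ and TDS57 from the item forms of the LANDED conditional theorems (p581141; TDS57 granted F″+ČNS+Cremona+KP) and the PUB bundles
  have hS : StarredOptimalManinUnitFiveSeven := hS' hPK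
  have hT : TwistDegreeStepFiveSeven := hT' hPK hF hK
  classical
  obtain ⟨e1, e2, dd, mz, au, c2, hC⟩ := hF
  have hnf : Literature.NumberTheory.EllipticCurves.ModularForms.exists_isNewformOf := hP.2.2.2.2.2.1
  -- (1) the proper Manin residue `R` of route AdditiveKolyvaginRoad (stmt-BirchSwinnertonDyer-20709) from THIS route's
  --     items: p ∈ {5,7} by the glue obligation G57 over K★ and TDS57; p ≥ 11 by p540328 over TDS11; then transport + frame.
  have hR : Summit.BirchSwinnertonDyer.BirchSwinnertonDyer.Theses.AdditiveKolyvaginRoad.ManinFrameResidueProperR := by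
    intro e1' e2' dd' hPub W _ _ p hp _ hp5 hadd hirr hres hall hr
    have hnf' : Literature.NumberTheory.EllipticCurves.ModularForms.exists_isNewformOf := hPub.2.2.2.2.2.1
    have hmem : ∃ (W₀ : WeierstrassCurve ℚ) (_ : W₀.IsElliptic) (_ : W₀.IsGloballyMinimal)
        (D₀ : Literature.NumberTheory.EllipticCurves.ModularForms.ModularParametrizationData W₀
          (W.conductorNorm ℤ)), WeierstrassCurve.IsIsogenous W W₀ ∧ ¬ (p : ℤ) ∣ D₀.c := by
      rcases lt_or_ge p 11 with h11 | h11
      · exact hG hnf' dd' hS hT W p hp5 h11 hadd hirr hres hall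
      · exact Summit.BirchSwinnertonDyer.BirchSwinnertonDyer.Theorems.ManinFrameResidueProperTwistDegree.stub_memberManinUnit_ordinary_of_twistDegreeStep
          e1' e2' dd' hnf' W p h11 hadd hirr hres
          (fun V _ _ _ Wf _ _ _ C hiso hGo hV4 hCV =>
            hO hnf' W p h11 hadd hirr hres hall V Wf C hiso hGo hV4 hCV)
    obtain ⟨W₀, hE₀, hM₀, D₀, hiso, hc₀⟩ := hmem
    haveI := hE₀
    haveI := hM₀
    obtain ⟨Dt, hc⟩ :=
      Summit.BirchSwinnertonDyer.BirchSwinnertonDyer.Theorems.ManinFrameTransport.exists_modularParametrizationData_not_dvd_of_partner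
        W hp.out hirr hiso D₀ hc₀
    have hp2 : p ≠ 2 := by omega
    exact Summit.BirchSwinnertonDyer.BirchSwinnertonDyer.Theorems.ManinFrameFromDatum.exists_oddHeegnerFrame_of_exists_not_dvd
      hnf' hPub.2.2.2.2.2.2.1 W p hr hp2 ⟨Dt, hc⟩
  -- (2) the Manin residue class from ČNS + the proved degree class + R (pure logic, as in AdditiveKolyvaginRoad.closes)
  have hD : Summit.BirchSwinnertonDyer.BirchSwinnertonDyer.Theses.AdditiveKolyvaginRoad.ManinFrameResidueDegreeClass :=
    Summit.BirchSwinnertonDyer.BirchSwinnertonDyer.Theorems.ManinFrameResidueDegreeClass.maninFrameResidueDegreeClass_proof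
  have hRes : Summit.BirchSwinnertonDyer.BirchSwinnertonDyer.Theses.AdditiveKolyvaginRoad.ManinFrameResidueClass := by
    intro hP' W _ _ p _ _ h5 hadd hirr hcl hr1
    by_cases hex : ∃ (W' : WeierstrassCurve ℚ) (_ : W'.IsElliptic) (_ : W'.IsGloballyMinimal)
        (D' : Literature.NumberTheory.EllipticCurves.ModularForms.ModularParametrizationData W' (W.conductorNorm ℤ)),
        WeierstrassCurve.IsIsogenous W W' ∧ ¬ p ∣ D'.modularDegree
    · exact hD hC hP' W p h5 hadd hirr hcl hex hr1
    · refine hR e1 e2 dd hP' W p h5 hadd hirr hcl ?_ hr1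
      intro W' _ _ D' hiso
      by_contra hnd
      exact hex ⟨W', ‹_›, ‹_›, D', hiso, hnd⟩
  -- (3) the Manin-good odd frame by the proved gen-2 glue over the proved class loci
  have hM : Summit.BirchSwinnertonDyer.BirchSwinnertonDyer.Theses.AdditiveKolyvaginRoad.ManinGoodOddFrameAdditive :=
    Summit.BirchSwinnertonDyer.BirchSwinnertonDyer.Theorems.ManinGoodOddFrameAdditiveResplitGlue.maninGoodOddFrameAdditiveResplitGlue_proof
      e1 e2 mz au c2
      Summit.BirchSwinnertonDyer.BirchSwinnertonDyer.Theorems.ManinFrameOffExceptionClass.maninFrameOffExceptionClass_proof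
      Summit.BirchSwinnertonDyer.BirchSwinnertonDyer.Theorems.ManinFrameIstarClass.maninFrameIstarClass_proof hRes
  -- (4) the proved additive Kolyvagin kernel gives the ♯ slice; the off-♯ slice is the shared item; glue of the W-ALL leaf
  have hSharp : Summit.BirchSwinnertonDyer.WAllExclAdditiveFiveLeRankOneSharp :=
    fun W _ _ p _ hCM hp5 hadd hr1 hs hsp htwo htam =>
      Summit.BirchSwinnertonDyer.BirchSwinnertonDyer.Theorems.AdditiveKolyvaginKernel.additiveKolyvaginKernel_proof
        hP hM h₁ h₀ W p hCM hp5 hadd hr1 hs hsp htwo htam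
  exact Summit.BirchSwinnertonDyer.wAllExclAdditiveFiveLeRankOne_of_sharp_of_offSharp hSharp hoff

end Summit.BirchSwinnertonDyer.BirchSwinnertonDyer.Theses.EdixhovenFibreFiveSeven
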